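import Summits.ResolutionOfSingularities.ResolutionOfSingularities.Theorems.MarkedTransferCampaignW46WWalkTerminates
import HarnessLib

/-!
# [OURS · L1 W4.6 rung (iii)] THE TYPED RUNGS over an algebraically closed field: the typed Th. 16.6 procedure (literal centre rule and
# ∇-centred) has no infinite run inside o1's regime of record `regimeMohWindowSurfaceInsep`, for EVERY notion instance and reading

Cell `res-hironaka`, LADDER-RESOLUTION rung L (D-0089), slot W4.6 rung (iii); seat res-L1-s46-pv-5 (gen 6). Host route MarkedTransfer,
`--supports stmt-ResolutionOfSingularities-16155 --as helper`; kind proof (def-free). Corollary of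
`…WWalkTerminates.mohWindowSurfaceInsepPermissiblyTerminates_of_isAlgClosed` through o1's
`terminates_and_terminatesNabla_of_mohWindowSurfaceInsepPermissiblyTerminates` and the antitone sub-rungs of res-L1-s46-pv-6.

HONEST FRAMING. OURS; nothing here is a statement of H. Hironaka's manuscript [Hironaka2017] and nothing of it is used. AI-written;
AI review is weaker than expert review. No `sorry`; axioms standard. [folklore]
-/

noncomputable section

set_option linter.dupNamespace false -- mandated namespace of this single-conjunct summit

namespace Summit.ResolutionOfSingularities.ResolutionOfSingularities.Theorems

namespace CampaignW46

namespace WWalk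

open Literature.AlgebraicGeometry.Hironaka2017.Datum

variable (p : ℕ) [hp : Fact p.Prime] (K : Type) [Field K] [CharP K p] [IsAlgClosed K]

/-- **The typed rungs (iii) over an algebraically closed field, every `p`, every notion instance and reading.** [folklore] -/
theorem terminates_regimeMohWindowSurfaceInsep_of_isAlgClosed (n : ℕ) (N : Notions.{0} n) (Rd : Reading p K N) :
    Terminates N Rd (regimeMohWindowSurfaceInsep (p := p) (K := K)) ∧
      TerminatesNabla N Rd (regimeMohWindowSurfaceInsep (p := p) (K := K)) :=
  terminates_and_terminatesNabla_of_mohWindowSurfaceInsepPermissiblyTerminates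
    (mohWindowSurfaceInsepPermissiblyTerminates_of_isAlgClosed (p := p) (K := K)) n N Rd

/-- The formally purely inseparable sub-rung (res-L1-s46-pv-6's `MohWindowSurfaceFormalInsepPermissiblyTerminates`) follows again, now from
o1's full rung. [folklore] -/
theorem mohWindowSurfaceFormalInsepPermissiblyTerminates_of_isAlgClosed' : MohWindowSurfaceFormalInsepPermissiblyTerminates p K :=
  mohWindowSurfaceFormalInsepPermissiblyTerminates_of_insep (mohWindowSurfaceInsepPermissiblyTerminates_of_isAlgClosed (p := p) (K := K))

end WWalk

end CampaignW46

end Summit.ResolutionOfSingularities.ResolutionOfSingularities.Theorems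

end
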